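import Literature.NumberTheory.Automorphic.Liu2021.Def412AdmissibleIffParity        -- ★ `embedding_of_isReal_lt_zero_of_coe_eq_mul_self`, `ne_zero_of_coe_eq_mul_self`
import Literature.NumberTheory.QuadraticForms.PrescribedNormClassesCM               -- ★ `exists_prescribed_normClass_sign_iff_even` (Hilbert reciprocity, O'Meara 71:18)
import Literature.NumberTheory.Rogawski1990.CohomologicalFinComponentIsTheta        -- ★ (C♭)-telescope vocabulary of the E3♭ text
import Summits.HodgeConjecture.CorCM.B01.Transposition.Item6OmegaChiSplitting      -- ★ `isCompatible_chiSplittingLine` family (E3♭ text)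
import HarnessLib

/-!
# Crux `H413`, programme P2 — **E3♭ FROM ITS ARCHIMEDEAN CORE: Hilbert reciprocity removes every finite place from the parity letter**
# (`even_ncard_locF_ne_one_add_card_neg` = «HR-a»; `e3flat_of_arch : ‹E3♭∞› → ‹E3♭›`)

Cell hodgecm-mathlib (D-0151), FLOOR 0, crux item H413 = stmt-HodgeConjecture-24833, route of record `HCCMUnconditional`; programme P2, socket
27455 `F0HdictE`; the E3 RE-CUT sub-line `Cruxes/H413/Lines/F0_P2E3ParityRecut.lean` (a3adf85a083c77b9) carries the ONE remaining engine letter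
on the socket, `stub_E3flat_automorphicParity : StubE3FlatAutomorphicParity` (:127; director s536 (1) «E3♭ GO», an (E)-row = in-house
mathematics).  Author B-p18 (g27) (free hand named in s536 (1)).  THEOREMS ONLY (no `def`, no instance, no notation, no named fact, no `sorry`);
`--supports stmt-HodgeConjecture-24833 --as helper`; imports NO `Cruxes/…/Lines` module (O50-1): the E3♭ text is PASTED VERBATIM (tree :128–157).
HC_CM is proved only modulo the printed citations until rung 0 closes; this file discharges no printed citation and does NOT prove E3♭ — it
re-cuts it.

## Content
* §1 «HR-a» `even_ncard_locF_ne_one_add_card_neg` — for a CM field `L`, `L⁺ = maximalRealSubfield L`, `d = imagUnitSq L = δ²` (totally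
  negative) and EVERY `a ∈ (L⁺)ˣ`: `#{v finite : [a]_v ≠ 1 in L⁺_vˣ ⧸ N(L_vˣ)} + #{w : InfinitePlace L⁺ ∣ w(a) < 0}` is EVEN.  This is Hilbert
  reciprocity `∏_v (a, d)_v = 1` read through «class `≠ 1` ⟺ symbol `−1`» at the finite places and «`(a,d)_w = −1` ⟺ `w(a) < 0`» at the
  (real) infinite places (`d < 0` there): literally the `→` half of ★ `QuadraticForms.exists_prescribed_normClass_sign_iff_even` at `θ := a`,
  `ε := locF a`, `T := {w ∣ w(a) < 0}`.
* §2 `e3flat_of_arch` — E3♭ follows from its ARCHIMEDEAN CORE «E3♭∞»: same telescope and hypotheses as E3♭ (tree :128–154 VERBATIM), conclusion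
  `Even (#{w : InfinitePlace L⁺ ∣ w(a) < 0} + #{φ ∈ Φ_μ ∣ 0 < Im φ((2δ)⁻¹)})` — no finite place, no local norm class: «the number of real places
  where the line `a` is negative and the number of members of the CM type `Φ_μ` sending `(2δ)⁻¹` to the upper half plane have the same parity».
  Proof: `Even (F + T)` (§1) and `Even (T + A)` (E3♭∞) give `Even (F + A)` (`Nat.even_add`).
So the engine owes only the archimedean statement: the ± label of the holomorphic ∕ antiholomorphic cotangent member at `ι` and of the members at
the definite places against `(Φ_μ, δ, sgn_w a)`, plus the global sign law; the finite-place labels enter only through their product, which IS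
`∏_w sgn_w(a)` by §1 once labels are norm classes.

## References
* [Omeara1963] O. T. O'Meara, *Introduction to Quadratic Forms* (1963): §71 Thm. 71:18 (Hilbert reciprocity), §63B Cor. 63:13a, §65A.
* [Liu2021] Y. Liu, Camb. J. Math. 9 (2021) = arXiv:2102.11518: Def. 4.11–4.12 (l. 2083–2108), Prop. 4.13, Rem. 4.14.
* [Rogawski1992] J. Rogawski, *The multiplicity formula for A-packets* (1992): Thm 1.1.  [Rogawski1990] Ann. of Math. Stud. 123: §12.3, Thm 14.6.4.
-/

set_option autoImplicit false
-- the mandated namespace has the single-problem summit's repeated segment (`HodgeConjecture.HodgeConjecture`)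
set_option linter.dupNamespace false

noncomputable section

namespace Summit.HodgeConjecture.HodgeConjecture.Cruxes.H413.F0P2lE3FlatOfArch

open scoped Matrix ComplexOrder
open NumberField NumberField.InfinitePlace IsDedekindDomain MeasureTheory
open Literature.NumberTheory Literature.NumberTheory.Automorphic Literature.NumberTheory.Automorphic.UnitaryGroup
open Literature.NumberTheory.Automorphic.UnitaryGroup.CotangentForms
open Literature.NumberTheory.Automorphic.Liu2021 Literature.NumberTheory.Automorphic.Liu2021.AppendixC
open Literature.NumberTheory.Automorphic.Liu2021.Def411WeilCarriers
open Literature.NumberTheory.Automorphic.Liu2021.Def411WeilCarriersDoubling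
open Literature.NumberTheory.Automorphic.IdeleClassGroup
open Literature.NumberTheory.GelbartRogawski1991 Literature.NumberTheory.GelbartRogawski1991.UnitaryDualPair
open Literature.NumberTheory.GelbartRogawski1991.UnitaryDualPair.WeilCoinv
open Literature.RepresentationTheory Literature.RepresentationTheory.Liu2021
open Literature.NumberTheory.Rogawski1990
open Literature.NumberTheory.QuadraticForms
open Summit.HodgeConjecture.CorCM
open Summit.HodgeConjecture.CorCM.Transposition

/-! ## §1 HR-a: Hilbert reciprocity for the norm classes and real signs of a line -/

/-- **HR-a — the norm classes and the real signs of a GLOBAL line have even total count.**  For a CM field `L` with maximal real subfield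
`L⁺`, `d = imagUnitSq L = δ²` and every `a ∈ (L⁺)ˣ`: the number of finite places `v` of `L⁺` with `[a]_v ≠ 1` in `L⁺_vˣ ⧸ N(L⁺_v(√d)ˣ)`
plus the number of (real) infinite places `w` of `L⁺` with `w(a) < 0` is even — Hilbert reciprocity `∏_v (a,d)_v = 1` (O'Meara 71:18) with
«class `≠ 1` ⟺ symbol `= −1`» (63:13a ∕ 65A) and, `d` being totally negative, «`(a,d)_w = −1` ⟺ `w(a) < 0`»; the `→` half of ★
`exists_prescribed_normClass_sign_iff_even` at `θ := a`, `ε := locF a`, `T := {w ∣ w(a) < 0}`.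
[cite: Omeara1963, §71 Thm. 71:18; §63B Cor. 63:13a; §65A] [cite: Liu2021, Def. 4.11–4.12 (l. 2088, 2105)] -/
theorem even_ncard_locF_ne_one_add_card_neg (L : Type) [Field L] [NumberField L] [IsCMField L]
    (a : (↥(maximalRealSubfield L))ˣ) :
    Even ({v : HeightOneSpectrum (𝓞 ↥(maximalRealSubfield L)) |
            locF (↥(maximalRealSubfield L)) (imagUnitSq L) a v ≠ 1}.ncard +
      (Finset.univ.filter fun w : InfinitePlace ↥(maximalRealSubfield L) =>
        InfinitePlace.embedding_of_isReal (IsTotallyReal.isReal w) (a : ↥(maximalRealSubfield L)) < 0).card) := by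
  classical
  have hd0 : imagUnitSq L ≠ 0 := ne_zero_of_coe_eq_mul_self (imagUnit_ne_zero L) (imagUnit_mul_self L).symm
  have hdneg : ∀ (w : InfinitePlace ↥(maximalRealSubfield L)) (hw : w.IsReal),
      InfinitePlace.embedding_of_isReal hw (imagUnitSq L) < 0 :=
    embedding_of_isReal_lt_zero_of_coe_eq_mul_self (complexConj_imagUnit L) (imagUnit_ne_zero L) (imagUnit_mul_self L).symm
  have h := (exists_prescribed_normClass_sign_iff_even (↥(maximalRealSubfield L)) (imagUnitSq L) hd0 hdneg
    (locF (↥(maximalRealSubfield L)) (imagUnitSq L) a)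
    (Finset.univ.filter fun w : InfinitePlace ↥(maximalRealSubfield L) =>
      InfinitePlace.embedding_of_isReal (IsTotallyReal.isReal w) (a : ↥(maximalRealSubfield L)) < 0)
    (fun w _ => IsTotallyReal.isReal w)).mp
    ⟨a, fun v => (locF_apply (↥(maximalRealSubfield L)) (imagUnitSq L) a v).symm, fun w hw => by
      simp only [Finset.mem_filter, Finset.mem_univ, true_and]⟩
  exact h.2

/-! ## §2 E3♭ from its archimedean core -/

set_option synthInstance.maxHeartbeats 400000 in
set_option maxHeartbeats 16000000 in
/-- **E3♭ ⟸ E3♭∞ — the parity letter from its archimedean core.**  Hypothesis «E3♭∞»: the E3♭ telescope and hypotheses VERBATIM (tree sub-line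
`Lines/F0_P2E3ParityRecut.lean` a3adf85a :128–154: CM field `L`, `[L⁺:ℚ] ≥ 2`, `H` of signature `(2,1)` at `ι` and definite elsewhere, rational
frame `g`, transport `ιV`, automorphic measure `μA`, discrete automorphic `P` holomorphic-or-antiholomorphic COTANGENT at `ι`, conjugate-symplectic
weight-one `μ`, line `a ∈ (L⁺)ˣ`, `χ`, `P.HasFinComponent (rhoAtLine …[e₁] ιV a χ)`), with the ARCHIMEDEAN conclusion
`Even (#{w : InfinitePlace L⁺ ∣ w(a) < 0} + #{φ ∈ Φ_μ ∣ 0 < Im φ((2δ)⁻¹)})`.  Conclusion: the E3♭ body VERBATIM (:128–157).  Proof: HR-a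
(`Even (F + T)`) and E3♭∞ (`Even (T + A)`) give `Even (F + A)` by `Nat.even_add`.  What E3♭∞ still encodes: Rogawski's multiplicity formula for the
endoscopic packet containing `P` [Rogawski1992 Thm 1.1; Rogawski1990 Thm 14.6.4], in which the finite-place labels of the theta members enter only
through their product `∏_v [a]_v = ∏_w sgn_w(a)` (HR-a), leaving the archimedean labels against `(Φ_μ, δ, sgn_w a)`.
[cite: Liu2021, Prop. 4.13, Rem. 4.14, Def. 4.12] [cite: Rogawski1992, Thm 1.1] [cite: Omeara1963, §71 Thm. 71:18] -/
theorem e3flat_of_arch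
    (hA :
  ∀ (L : Type) [Field L] [NumberField L] [IsCMField L] (ι : L →+* ℂ) (H : Matrix (Fin 3) (Fin 3) L) (T : GL (Fin 3) ℂ)
    (hT : (T : Matrix (Fin 3) (Fin 3) ℂ)ᴴ * H.map ι * (T : Matrix (Fin 3) (Fin 3) ℂ) = Literature.Geometry.ComplexHyperbolic.BallModel.J),
    (∀ τ' : L →+* ℂ, InfinitePlace.mk τ' ≠ InfinitePlace.mk ι → (H.map τ').PosDef) → 2 ≤ Module.finrank ℚ ↥(maximalRealSubfield L) →
    ∀ {n' : ℕ} (e₁ : Fin 3 × Fin 1 ≃ Fin n') (dV : Fin 3 → L) (hdV : ∀ i, IsCMField.complexConj L (dV i) = dV i)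
      (hdV0 : ∀ i, dV i ≠ 0) (g : GL (Fin 3) L)
      (hg : ((g : Matrix (Fin 3) (Fin 3) L).map (cmConjRingHom L))ᵀ * H * (g : Matrix (Fin 3) (Fin 3) L) = Matrix.diagonal dV)
      (ιV : finAdelic (↥(maximalRealSubfield L)) L (IsCMField.complexConj L) 3 H →*
          finAdelic (↥(maximalRealSubfield L)) L (IsCMField.complexConj L) 3 (Matrix.diagonal dV)),
        (∀ k, ((ιV k : finAdelic (↥(maximalRealSubfield L)) L (IsCMField.complexConj L) 3 (Matrix.diagonal dV)) :
            GL (Fin 3) (FiniteAdeleRing (𝓞 L) L)) =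
          (toFinAdeleGL L 3 g)⁻¹ * (k : GL (Fin 3) (FiniteAdeleRing (𝓞 L) L)) * toFinAdeleGL L 3 g) →
        ∀ (μA : Measure (adelicGroupData (↥(maximalRealSubfield L)) L (IsCMField.complexConj L) 3 H).automorphicQuotient)
          [(adelicGroupData (↥(maximalRealSubfield L)) L (IsCMField.complexConj L) 3 H).IsAutomorphicMeasure μA],
          ∀ P : DiscreteAutomorphicRep (adelicGroupData (↥(maximalRealSubfield L)) L (IsCMField.complexConj L) 3 H) μA,
            (P.IsHolCotangentAt (cmArchSection L ι H T hT) (cmCompactFactor L ι H T hT) ∨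
              P.IsAntiholCotangentAt (cmArchSection L ι H T hT) (cmCompactFactor L ι H T hT)) →
            ∀ (μ : Literature.NumberTheory.Automorphic.IdeleClassGroup L →ₜ* Circle) (hμ : IsConjugateSymplectic L μ), HasWeight L μ 1 →
              ∀ (a : (↥(maximalRealSubfield L))ˣ) (χ : Chi (↥(maximalRealSubfield L)) L (IsCMField.complexConj L)),
                P.HasFinComponent
                  (rhoAtLine (↥(maximalRealSubfield L)) L (IsCMField.complexConj L) 3 e₁ (Matrix.diagonal dV)
                    (complexConj_imagUnit L) (imagUnit_ne_zero L) (imagUnit_mul_self L) (realDiagonal_isSymm L dV hdV)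
                    (isUnit_det_realDiagonal L dV hdV hdV0) (realDiagonal_map L dV hdV).symm
                    (fun a => isCompatible_chiSplittingLine L e₁ dV hdV hdV0 (toHeckeCharacter L μ)
                      (isUnitary_toHeckeCharacter L μ) ((isOscillatorChar_toHeckeCharacter_iff μ).mpr hμ)
                      (TW (↥(maximalRealSubfield L)) a) (isSymm_TW (↥(maximalRealSubfield L)) a)
                      (isUnit_det_TW (↥(maximalRealSubfield L)) a) (JW (↥(maximalRealSubfield L)) L a)
                      (JW_eq (↥(maximalRealSubfield L)) L a)) ιV a χ) →
                  Even ((Finset.univ.filter fun w : InfinitePlace ↥(maximalRealSubfield L) =>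
                            InfinitePlace.embedding_of_isReal (IsTotallyReal.isReal w) (a : ↥(maximalRealSubfield L)) < 0).card +
                    {φ : L →+* ℂ | φ ∈ hμ.cmType.1 ∧ 0 < (φ (2 * imagUnit L)⁻¹).im}.ncard)) :
  ∀ (L : Type) [Field L] [NumberField L] [IsCMField L] (ι : L →+* ℂ) (H : Matrix (Fin 3) (Fin 3) L) (T : GL (Fin 3) ℂ)
    (hT : (T : Matrix (Fin 3) (Fin 3) ℂ)ᴴ * H.map ι * (T : Matrix (Fin 3) (Fin 3) ℂ) = Literature.Geometry.ComplexHyperbolic.BallModel.J),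
    (∀ τ' : L →+* ℂ, InfinitePlace.mk τ' ≠ InfinitePlace.mk ι → (H.map τ').PosDef) → 2 ≤ Module.finrank ℚ ↥(maximalRealSubfield L) →
    ∀ {n' : ℕ} (e₁ : Fin 3 × Fin 1 ≃ Fin n') (dV : Fin 3 → L) (hdV : ∀ i, IsCMField.complexConj L (dV i) = dV i)
      (hdV0 : ∀ i, dV i ≠ 0) (g : GL (Fin 3) L)
      (hg : ((g : Matrix (Fin 3) (Fin 3) L).map (cmConjRingHom L))ᵀ * H * (g : Matrix (Fin 3) (Fin 3) L) = Matrix.diagonal dV)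
      (ιV : finAdelic (↥(maximalRealSubfield L)) L (IsCMField.complexConj L) 3 H →*
          finAdelic (↥(maximalRealSubfield L)) L (IsCMField.complexConj L) 3 (Matrix.diagonal dV)),
        (∀ k, ((ιV k : finAdelic (↥(maximalRealSubfield L)) L (IsCMField.complexConj L) 3 (Matrix.diagonal dV)) :
            GL (Fin 3) (FiniteAdeleRing (𝓞 L) L)) =
          (toFinAdeleGL L 3 g)⁻¹ * (k : GL (Fin 3) (FiniteAdeleRing (𝓞 L) L)) * toFinAdeleGL L 3 g) →
        ∀ (μA : Measure (adelicGroupData (↥(maximalRealSubfield L)) L (IsCMField.complexConj L) 3 H).automorphicQuotient)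
          [(adelicGroupData (↥(maximalRealSubfield L)) L (IsCMField.complexConj L) 3 H).IsAutomorphicMeasure μA],
          ∀ P : DiscreteAutomorphicRep (adelicGroupData (↥(maximalRealSubfield L)) L (IsCMField.complexConj L) 3 H) μA,
            (P.IsHolCotangentAt (cmArchSection L ι H T hT) (cmCompactFactor L ι H T hT) ∨
              P.IsAntiholCotangentAt (cmArchSection L ι H T hT) (cmCompactFactor L ι H T hT)) →
            ∀ (μ : Literature.NumberTheory.Automorphic.IdeleClassGroup L →ₜ* Circle) (hμ : IsConjugateSymplectic L μ), HasWeight L μ 1 →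
              ∀ (a : (↥(maximalRealSubfield L))ˣ) (χ : Chi (↥(maximalRealSubfield L)) L (IsCMField.complexConj L)),
                P.HasFinComponent
                  (rhoAtLine (↥(maximalRealSubfield L)) L (IsCMField.complexConj L) 3 e₁ (Matrix.diagonal dV)
                    (complexConj_imagUnit L) (imagUnit_ne_zero L) (imagUnit_mul_self L) (realDiagonal_isSymm L dV hdV)
                    (isUnit_det_realDiagonal L dV hdV hdV0) (realDiagonal_map L dV hdV).symm
                    (fun a => isCompatible_chiSplittingLine L e₁ dV hdV hdV0 (toHeckeCharacter L μ)
                      (isUnitary_toHeckeCharacter L μ) ((isOscillatorChar_toHeckeCharacter_iff μ).mpr hμ)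
                      (TW (↥(maximalRealSubfield L)) a) (isSymm_TW (↥(maximalRealSubfield L)) a)
                      (isUnit_det_TW (↥(maximalRealSubfield L)) a) (JW (↥(maximalRealSubfield L)) L a)
                      (JW_eq (↥(maximalRealSubfield L)) L a)) ιV a χ) →
                  Even ({v : HeightOneSpectrum (𝓞 ↥(maximalRealSubfield L)) |
                          locF (↥(maximalRealSubfield L)) (imagUnitSq L) a v ≠ 1}.ncard +
                    {φ : L →+* ℂ | φ ∈ hμ.cmType.1 ∧ 0 < (φ (2 * imagUnit L)⁻¹).im}.ncard) := by
  intro L _ _ _ ι H T hT hpos h2 n' e₁ dV hdV hdV0 g hg ιV hιV μA _ P hP μ hμ hw a χ hfc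
  have hTA := hA L ι H T hT hpos h2 e₁ dV hdV hdV0 g hg ιV hιV μA P hP μ hμ hw a χ hfc
  have hFT := even_ncard_locF_ne_one_add_card_neg L a
  rw [Nat.even_add] at hTA hFT ⊢
  exact hFT.trans hTA

end Summit.HodgeConjecture.HodgeConjecture.Cruxes.H413.F0P2lE3FlatOfArch

end
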